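import Summits.Ventures.PercRepro2.CaseOneTwoMarkFacts

/-!
# `a₃` adjacent exactly to `o` and `b`: the `b ∈ C₁`-masses
(blind cell PercRepro2, p1 g15; S5 §2.1 (K9) (o), proofs/P1-TWOMARK.md §7)

The double pinning `prob_twoPin` with the pointwise descriptions of `CaseOneTwoMark.lean` gives the
three masses of the `(i)`-side: `P(Q, B₁) = b₁ + p_o p_b (o₁ − o₁b₁ − bo₁ − ob₁)`,
`P(Q, A, B₁) = p_o(1 − p_b) o₁b₁ + (1 − p_o) p_b b₁ + p_o p_b (o₁ + b₁ − o₁b₁ − bo₁ − ob₁)`,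
`P(Q, A, B₁, O₂) = (1 − p_o) p_b ob₁` (base events `Q₀`, `O₁`, `O₂`, `B₁`, `B₂` as in
`CaseOneTwoMarkMass.lean`). -/

namespace Summit.Ventures.PercRepro2

namespace CaseOne

/-! ## The `b ∈ C₁`-masses of the class -/

section MassesI
variable {V : Type*} {E : Type*} [Fintype E] [DecidableEq E] {R : Type*} [CommRing R]
variable {ends : E → Sym2 V} {o b a₃ : V} {eo eb : E}

/-- **`P(Q, B₁)`** for `a₃ ~ {o, b}`: `P(Q, B₁) = b₁ + p_o p_b (o₁ − o₁b₁ − bo₁ − ob₁)`. -/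
theorem prob_QB1_twoMark (p : E → R) (h : IsTwoMarkAt ends o b a₃ eo eb) {a₁ a₂ : V} (h1 : a₁ ≠ a₃)
    (h2 : a₂ ≠ a₃) :
    prob p ((connEvent ends a₁ a₂)ᶜ ∩ connEvent ends a₁ b) =
      prob (Function.update (Function.update p eo 0) eb 0) ((connEvent ends a₁ a₂)ᶜ ∩ connEvent ends a₁ b) +
        p eo * p eb *
          (prob (Function.update (Function.update p eo 0) eb 0)
              ((connEvent ends a₁ a₂)ᶜ ∩ connEvent ends a₁ o) -
            prob (Function.update (Function.update p eo 0) eb 0)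
              ((connEvent ends a₁ a₂)ᶜ ∩ connEvent ends a₁ o ∩ connEvent ends a₁ b) -
            prob (Function.update (Function.update p eo 0) eb 0)
              ((connEvent ends a₁ a₂)ᶜ ∩ connEvent ends a₁ o ∩ connEvent ends a₂ b) -
            prob (Function.update (Function.update p eo 0) eb 0)
              ((connEvent ends a₁ a₂)ᶜ ∩ connEvent ends a₁ b ∩ connEvent ends a₂ o)) := by
  set p00 := Function.update (Function.update p eo 0) eb 0 with hp00
  have key := prob_twoPin p h.ne ((connEvent ends a₁ a₂)ᶜ ∩ connEvent ends a₁ b)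
    (((connEvent ends a₁ a₂)ᶜ ∩ connEvent ends a₁ o ∩ (connEvent ends a₂ b)ᶜ) ∪
      ((connEvent ends a₁ a₂)ᶜ ∩ connEvent ends a₁ b ∩ (connEvent ends a₁ o)ᶜ ∩ (connEvent ends a₂ o)ᶜ))
    ((connEvent ends a₁ a₂)ᶜ ∩ connEvent ends a₁ b) ((connEvent ends a₁ a₂)ᶜ ∩ connEvent ends a₁ b)
    ((connEvent ends a₁ a₂)ᶜ ∩ connEvent ends a₁ b) ?_ ?_ ?_ ?_
  · rw [key, ← hp00]
    rw [prob_union_of_disjoint p00 (Set.disjoint_left.2 fun ω hω hω' => hω'.1.2 hω.1.2)]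
    have s1 := prob_inter_add_prob_inter_compl p00 ((connEvent ends a₁ a₂)ᶜ ∩ connEvent ends a₁ o)
      (connEvent ends a₂ b)
    have s2 := prob_inter_add_prob_inter_compl p00
      ((connEvent ends a₁ a₂)ᶜ ∩ connEvent ends a₁ b ∩ (connEvent ends a₁ o)ᶜ) (connEvent ends a₂ o)
    have s3 := prob_inter_add_prob_inter_compl p00 ((connEvent ends a₁ a₂)ᶜ ∩ connEvent ends a₁ b)
      (connEvent ends a₁ o)
    have e2 : (connEvent ends a₁ a₂)ᶜ ∩ connEvent ends a₁ b ∩ (connEvent ends a₁ o)ᶜ ∩ connEvent ends a₂ o =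
        (connEvent ends a₁ a₂)ᶜ ∩ connEvent ends a₁ b ∩ connEvent ends a₂ o := by
      ext ω
      simp only [Set.mem_inter_iff, Set.mem_compl_iff, mem_connEvent]
      have t1 : Conn ends ω a₁ o → Conn ends ω a₂ o → Conn ends ω a₁ a₂ :=
        fun x y => conn_trans x (conn_symm y)
      tauto
    have e3 : (connEvent ends a₁ a₂)ᶜ ∩ connEvent ends a₁ b ∩ connEvent ends a₁ o =
        (connEvent ends a₁ a₂)ᶜ ∩ connEvent ends a₁ o ∩ connEvent ends a₁ b := Set.inter_right_comm _ _ _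
    rw [e2] at s2
    rw [e3] at s3
    linear_combination (p eo * p eb) * (s1 + s2 + s3)
  · intro ω ho hb
    rw [openCC_tt ho hb]
    simp only [Set.mem_compl_iff, Set.mem_inter_iff, Set.mem_union, mem_connEvent]
    rw [conn_both_iff h ω h1 h2, conn_both_iff h ω h1 h.ne_b, base2_eq_self ho hb,
      conn_comm_iff ω b a₂, conn_comm_iff ω o a₂]
    have t1 : Conn ends ω a₁ o → Conn ends ω a₂ o → Conn ends ω a₁ a₂ :=
      fun x y => conn_trans x (conn_symm y)
    have t2 : Conn ends ω a₁ b → Conn ends ω a₂ b → Conn ends ω a₁ a₂ :=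
      fun x y => conn_trans x (conn_symm y)
    have t3 : Conn ends ω b b := conn_refl _ _ _
    tauto
  · intro ω ho hb
    rw [openCC_tf h.ne ho hb]
    simp only [Set.mem_compl_iff, Set.mem_inter_iff, mem_connEvent]
    rw [conn_open_o_iff h ω h1 h2, conn_open_o_iff h ω h1 h.ne_b, base2_eq_self ho hb]
  · intro ω ho hb
    rw [openCC_ft ho hb]
    simp only [Set.mem_compl_iff, Set.mem_inter_iff, mem_connEvent]
    rw [conn_open_b_iff h ω h1 h2, conn_open_b_iff h ω h1 h.ne_b, base2_eq_self ho hb]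
  · intro ω ho hb
    rw [openCC_ff ho hb, base2_eq_self ho hb]

/-- **`P(Q, A, B₁)`** for `a₃ ~ {o, b}`:
`P(Q, A, B₁) = p_o(1 − p_b) o₁b₁ + (1 − p_o) p_b b₁ + p_o p_b (o₁ + b₁ − o₁b₁ − bo₁ − ob₁)`. -/
theorem prob_QAB1_twoMark (p : E → R) (h : IsTwoMarkAt ends o b a₃ eo eb) {a₁ a₂ : V} (h1 : a₁ ≠ a₃)
    (h2 : a₂ ≠ a₃) :
    prob p ((connEvent ends a₁ a₂)ᶜ ∩ connEvent ends a₁ a₃ ∩ connEvent ends a₁ b) =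
      p eo * (1 - p eb) *
          prob (Function.update (Function.update p eo 0) eb 0)
            ((connEvent ends a₁ a₂)ᶜ ∩ connEvent ends a₁ o ∩ connEvent ends a₁ b) +
        (1 - p eo) * p eb *
          prob (Function.update (Function.update p eo 0) eb 0)
            ((connEvent ends a₁ a₂)ᶜ ∩ connEvent ends a₁ b) +
        p eo * p eb *
          (prob (Function.update (Function.update p eo 0) eb 0)
              ((connEvent ends a₁ a₂)ᶜ ∩ connEvent ends a₁ o) +
            prob (Function.update (Function.update p eo 0) eb 0)
              ((connEvent ends a₁ a₂)ᶜ ∩ connEvent ends a₁ b) -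
            prob (Function.update (Function.update p eo 0) eb 0)
              ((connEvent ends a₁ a₂)ᶜ ∩ connEvent ends a₁ o ∩ connEvent ends a₁ b) -
            prob (Function.update (Function.update p eo 0) eb 0)
              ((connEvent ends a₁ a₂)ᶜ ∩ connEvent ends a₁ o ∩ connEvent ends a₂ b) -
            prob (Function.update (Function.update p eo 0) eb 0)
              ((connEvent ends a₁ a₂)ᶜ ∩ connEvent ends a₁ b ∩ connEvent ends a₂ o)) := by
  set p00 := Function.update (Function.update p eo 0) eb 0 with hp00
  have key := prob_twoPin p h.ne ((connEvent ends a₁ a₂)ᶜ ∩ connEvent ends a₁ a₃ ∩ connEvent ends a₁ b)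
    (((connEvent ends a₁ a₂)ᶜ ∩ connEvent ends a₁ o ∩ (connEvent ends a₂ b)ᶜ) ∪
      ((connEvent ends a₁ a₂)ᶜ ∩ connEvent ends a₁ b ∩ (connEvent ends a₁ o)ᶜ ∩ (connEvent ends a₂ o)ᶜ))
    ((connEvent ends a₁ a₂)ᶜ ∩ connEvent ends a₁ o ∩ connEvent ends a₁ b)
    ((connEvent ends a₁ a₂)ᶜ ∩ connEvent ends a₁ b) ∅ ?_ ?_ ?_ ?_
  · rw [key, ← hp00, prob_empty]
    rw [prob_union_of_disjoint p00 (Set.disjoint_left.2 fun ω hω hω' => hω'.1.2 hω.1.2)]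
    have s1 := prob_inter_add_prob_inter_compl p00 ((connEvent ends a₁ a₂)ᶜ ∩ connEvent ends a₁ o)
      (connEvent ends a₂ b)
    have s2 := prob_inter_add_prob_inter_compl p00
      ((connEvent ends a₁ a₂)ᶜ ∩ connEvent ends a₁ b ∩ (connEvent ends a₁ o)ᶜ) (connEvent ends a₂ o)
    have s3 := prob_inter_add_prob_inter_compl p00 ((connEvent ends a₁ a₂)ᶜ ∩ connEvent ends a₁ b)
      (connEvent ends a₁ o)
    have e2 : (connEvent ends a₁ a₂)ᶜ ∩ connEvent ends a₁ b ∩ (connEvent ends a₁ o)ᶜ ∩ connEvent ends a₂ o =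
        (connEvent ends a₁ a₂)ᶜ ∩ connEvent ends a₁ b ∩ connEvent ends a₂ o := by
      ext ω
      simp only [Set.mem_inter_iff, Set.mem_compl_iff, mem_connEvent]
      have t1 : Conn ends ω a₁ o → Conn ends ω a₂ o → Conn ends ω a₁ a₂ :=
        fun x y => conn_trans x (conn_symm y)
      tauto
    have e3 : (connEvent ends a₁ a₂)ᶜ ∩ connEvent ends a₁ b ∩ connEvent ends a₁ o =
        (connEvent ends a₁ a₂)ᶜ ∩ connEvent ends a₁ o ∩ connEvent ends a₁ b := Set.inter_right_comm _ _ _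
    rw [e2] at s2
    rw [e3] at s3
    linear_combination (p eo * p eb) * (s1 + s2 + s3)
  · intro ω ho hb
    rw [openCC_tt ho hb]
    simp only [Set.mem_compl_iff, Set.mem_inter_iff, Set.mem_union, mem_connEvent]
    rw [conn_both_iff h ω h1 h2, conn_both_a3_iff h ω h1, conn_both_iff h ω h1 h.ne_b,
      base2_eq_self ho hb, conn_comm_iff ω b a₂, conn_comm_iff ω o a₂]
    have t1 : Conn ends ω a₁ o → Conn ends ω a₂ o → Conn ends ω a₁ a₂ :=
      fun x y => conn_trans x (conn_symm y)
    have t2 : Conn ends ω a₁ b → Conn ends ω a₂ b → Conn ends ω a₁ a₂ :=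
      fun x y => conn_trans x (conn_symm y)
    have t3 : Conn ends ω b b := conn_refl _ _ _
    tauto
  · intro ω ho hb
    rw [openCC_tf h.ne ho hb]
    simp only [Set.mem_compl_iff, Set.mem_inter_iff, mem_connEvent]
    rw [conn_open_o_iff h ω h1 h2, conn_open_o_a3_iff h ω h1, conn_open_o_iff h ω h1 h.ne_b,
      base2_eq_self ho hb]
  · intro ω ho hb
    rw [openCC_ft ho hb]
    simp only [Set.mem_compl_iff, Set.mem_inter_iff, mem_connEvent]
    rw [conn_open_b_iff h ω h1 h2, conn_open_b_a3_iff h ω h1, conn_open_b_iff h ω h1 h.ne_b,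
      base2_eq_self ho hb]
    tauto
  · intro ω ho hb
    rw [openCC_ff ho hb]
    simp only [Set.mem_compl_iff, Set.mem_inter_iff, mem_connEvent, Set.mem_empty_iff_false,
      iff_false]
    exact fun hh => not_conn_base2 h ω h1 hh.1.2

/-- **`P(Q, A, B₁, O₂)`** for `a₃ ~ {o, b}`: `P(Q, A, B₁, O₂) = (1 − p_o) p_b ob₁`. -/
theorem prob_QAB1O_twoMark (p : E → R) (h : IsTwoMarkAt ends o b a₃ eo eb) {a₁ a₂ : V} (h1 : a₁ ≠ a₃)
    (h2 : a₂ ≠ a₃) :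
    prob p ((connEvent ends a₁ a₂)ᶜ ∩ connEvent ends a₁ a₃ ∩ connEvent ends a₁ b ∩ connEvent ends a₂ o) =
      (1 - p eo) * p eb *
        prob (Function.update (Function.update p eo 0) eb 0)
          ((connEvent ends a₁ a₂)ᶜ ∩ connEvent ends a₁ b ∩ connEvent ends a₂ o) := by
  set p00 := Function.update (Function.update p eo 0) eb 0 with hp00
  have key := prob_twoPin p h.ne
    ((connEvent ends a₁ a₂)ᶜ ∩ connEvent ends a₁ a₃ ∩ connEvent ends a₁ b ∩ connEvent ends a₂ o)
    ∅ ∅ ((connEvent ends a₁ a₂)ᶜ ∩ connEvent ends a₁ b ∩ connEvent ends a₂ o) ∅ ?_ ?_ ?_ ?_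
  · rw [key, ← hp00, prob_empty]
    ring
  · intro ω ho hb
    rw [openCC_tt ho hb]
    simp only [Set.mem_compl_iff, Set.mem_inter_iff, mem_connEvent, Set.mem_empty_iff_false,
      iff_false]
    rw [conn_both_iff h ω h1 h2, conn_both_a3_iff h ω h1, conn_both_iff h ω h1 h.ne_b,
      conn_both_iff h ω h2 h.ne_o, base2_eq_self ho hb, conn_comm_iff ω b a₂, conn_comm_iff ω o a₂]
    have t1 : Conn ends ω a₁ o → Conn ends ω a₂ o → Conn ends ω a₁ a₂ :=
      fun x y => conn_trans x (conn_symm y)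
    have t2 : Conn ends ω a₁ b → Conn ends ω a₂ b → Conn ends ω a₁ a₂ :=
      fun x y => conn_trans x (conn_symm y)
    have t3 : Conn ends ω b b := conn_refl _ _ _
    have t4 : Conn ends ω o o := conn_refl _ _ _
    tauto
  · intro ω ho hb
    rw [openCC_tf h.ne ho hb]
    simp only [Set.mem_compl_iff, Set.mem_inter_iff, mem_connEvent, Set.mem_empty_iff_false,
      iff_false]
    rw [conn_open_o_iff h ω h1 h2, conn_open_o_a3_iff h ω h1, conn_open_o_iff h ω h1 h.ne_b,
      conn_open_o_iff h ω h2 h.ne_o, base2_eq_self ho hb]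
    have t1 : Conn ends ω a₁ o → Conn ends ω a₂ o → Conn ends ω a₁ a₂ :=
      fun x y => conn_trans x (conn_symm y)
    tauto
  · intro ω ho hb
    rw [openCC_ft ho hb]
    simp only [Set.mem_compl_iff, Set.mem_inter_iff, mem_connEvent]
    rw [conn_open_b_iff h ω h1 h2, conn_open_b_a3_iff h ω h1, conn_open_b_iff h ω h1 h.ne_b,
      conn_open_b_iff h ω h2 h.ne_o, base2_eq_self ho hb]
    tauto
  · intro ω ho hb
    rw [openCC_ff ho hb]
    simp only [Set.mem_compl_iff, Set.mem_inter_iff, mem_connEvent, Set.mem_empty_iff_false,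
      iff_false]
    exact fun hh => not_conn_base2 h ω h1 hh.1.1.2

end MassesI

end CaseOne

end Summit.Ventures.PercRepro2
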